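import Mathlib
import Summits.Ventures.PercRepro2.CoinFourAtomSandwich
import Summits.Ventures.PercRepro2.CoinKSureAD

/-!
# The four-atom sandwich pushed forward from a core: covering markers for ANY log-supermodular pair
(blind cell PercRepro2, night-2 g17; proofs/NIGHT2-DARC.md §57)

Push the cleared functional of row 2′DARC forward along the two point markers `m₁, m₂`: the core
levels fall into the four atoms `00, 10, 01, 11`, the `R`-law `G` into `r₀, r₁, r₂, r₁₂` and the
gate `G'` into `g₀, g₁, g₂, g₁₂` (fibre sums).  The four functions theorem keeps both pushforwards
log-supermodular (`r₁r₂ ≤ r₀r₁₂`, `g₁g₂ ≤ g₀g₁₂`), and when the gate equals the `R`-law on every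
level missing BOTH markers (`h00` — «the free arc is unreachable unless a marker is in the
cluster», the covering-marker condition) and is dominated by it everywhere, `fourAtom_sandwich`
gives `T ≥ 0`: **`fourAtom_functional_nonneg`**.  No entry set, no cross-Holley, no clean-state
decomposition — the only structure used is the log-supermodularity of the two laws on the core.
This is the abstract engine of the chained OR-vertex theorem with covering markers
(`CoinChainCover.lean`).
-/

namespace Summit.Ventures.PercRepro2.Coin

open Classical

section FourAtomPush

variable {V : Type*} [DecidableEq V] {R : Type*} [Field R] [LinearOrder R] [IsStrictOrderedRing R]

omit [LinearOrder R] [IsStrictOrderedRing R] in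
/-- The point marker of a meet is the product of the markers. -/
lemma ite_mem_inter (m : V) (s t : Finset V) :
    (if m ∈ s ∩ t then (1 : R) else 0) = (if m ∈ s then (1 : R) else 0) * (if m ∈ t then (1 : R) else 0) := by
  by_cases hs : m ∈ s <;> by_cases ht : m ∈ t <;> simp [hs, ht]

omit [LinearOrder R] [IsStrictOrderedRing R] in
/-- The point marker of a join. -/
lemma ite_mem_union (m : V) (s t : Finset V) :
    (if m ∈ s ∪ t then (1 : R) else 0) =
      (if m ∈ s then (1 : R) else 0) + (if m ∈ t then (1 : R) else 0) -
        (if m ∈ s then (1 : R) else 0) * (if m ∈ t then (1 : R) else 0) := by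
  by_cases hs : m ∈ s <;> by_cases ht : m ∈ t <;> simp [hs, ht]

omit [LinearOrder R] [IsStrictOrderedRing R] in
/-- A point marker is `0` or `1`. -/
lemma ite_mem_zero_or_one (m : V) (W : Finset V) :
    (if m ∈ W then (1 : R) else 0) = 0 ∨ (if m ∈ W then (1 : R) else 0) = 1 := by
  by_cases h : m ∈ W <;> simp [h]

/-- A point marker is nonnegative. -/
lemma ite_mem_nonneg (m : V) (W : Finset V) : (0 : R) ≤ if m ∈ W then (1 : R) else 0 := by
  split_ifs <;> norm_num

/-- A point marker is at most `1`. -/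
lemma ite_mem_le_one (m : V) (W : Finset V) : (if m ∈ W then (1 : R) else 0) ≤ 1 := by
  split_ifs <;> norm_num

/-- The pushforward of a log-supermodular weight along two point markers is log-supermodular
on the four atoms: `(∑ F·x(1−y)) (∑ F·(1−x)y) ≤ (∑ F·(1−x)(1−y)) (∑ F·xy)`. -/
lemma atom_lsm (U : Finset V) (F : Finset V → R) (m₁ m₂ : V) (hF0 : ∀ W, 0 ≤ F W)
    (hF : ∀ s ⊆ U, ∀ t ⊆ U, F s * F t ≤ F (s ∩ t) * F (s ∪ t)) :
    (∑ W ∈ U.powerset, F W * ((if m₁ ∈ W then (1 : R) else 0) * (1 - if m₂ ∈ W then (1 : R) else 0))) *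
      (∑ W ∈ U.powerset, F W * ((1 - if m₁ ∈ W then (1 : R) else 0) * (if m₂ ∈ W then (1 : R) else 0))) ≤
    (∑ W ∈ U.powerset, F W * ((1 - if m₁ ∈ W then (1 : R) else 0) * (1 - if m₂ ∈ W then (1 : R) else 0))) *
      (∑ W ∈ U.powerset, F W * ((if m₁ ∈ W then (1 : R) else 0) * (if m₂ ∈ W then (1 : R) else 0))) := by
  have hx0 := fun W => ite_mem_nonneg (R := R) m₁ W
  have hx1 := fun W => ite_mem_le_one (R := R) m₁ W
  have hy0 := fun W => ite_mem_nonneg (R := R) m₂ W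
  have hy1 := fun W => ite_mem_le_one (R := R) m₂ W
  refine ad_pointwise U _ _ _ _
    (fun W => mul_nonneg (hF0 W) (mul_nonneg (hx0 W) (by linarith [hy1 W])))
    (fun W => mul_nonneg (hF0 W) (mul_nonneg (by linarith [hx1 W]) (hy0 W)))
    (fun W => mul_nonneg (hF0 W) (mul_nonneg (by linarith [hx1 W]) (by linarith [hy1 W])))
    (fun W => mul_nonneg (hF0 W) (mul_nonneg (hx0 W) (hy0 W))) ?_
  intro s hs t ht
  rw [ite_mem_inter m₁ s t, ite_mem_inter m₂ s t, ite_mem_union m₁ s t, ite_mem_union m₂ s t]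
  have hFF := hF s hs t ht
  have hF1 := mul_nonneg (hF0 (s ∩ t)) (hF0 (s ∪ t))
  rcases ite_mem_zero_or_one (R := R) m₁ s with hxs | hxs <;>
    rcases ite_mem_zero_or_one (R := R) m₂ s with hys | hys <;>
    rcases ite_mem_zero_or_one (R := R) m₁ t with hxt | hxt <;>
    rcases ite_mem_zero_or_one (R := R) m₂ t with hyt | hyt <;>
    rw [hxs, hys, hxt, hyt] <;> norm_num <;> linarith

/-- **THE FOUR-ATOM SANDWICH ON A CORE (covering markers).** `G` (the `R`-law) and `G'` (the
gate) nonnegative and log-supermodular on `U.powerset`, `G' ≤ G`, and `G' = G` on every level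
missing both markers `m₁, m₂`.  Then the cleared functional `Λ²M₁₁ − ΛΛ₁M₂ − ΛΛ₂M₁ + Λ₁Λ₂M` is
nonnegative. -/
theorem fourAtom_functional_nonneg (U : Finset V) (G G' : Finset V → R) (m₁ m₂ : V)
    (hG : ∀ W, 0 ≤ G W) (hG' : ∀ W, 0 ≤ G' W)
    (wLL : ∀ s ⊆ U, ∀ t ⊆ U, G s * G t ≤ G (s ∩ t) * G (s ∪ t))
    (wMM : ∀ s ⊆ U, ∀ t ⊆ U, G' s * G' t ≤ G' (s ∩ t) * G' (s ∪ t))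
    (hle : ∀ W, G' W ≤ G W)
    (h00 : ∀ W, m₁ ∉ W → m₂ ∉ W → G' W = G W) :
    0 ≤ (∑ W ∈ U.powerset, G W) ^ 2 *
          (∑ W ∈ U.powerset, G' W * ((if m₁ ∈ W then (1 : R) else 0) * (if m₂ ∈ W then (1 : R) else 0)))
        - (∑ W ∈ U.powerset, G W) * (∑ W ∈ U.powerset, G W * (if m₁ ∈ W then (1 : R) else 0)) *
          (∑ W ∈ U.powerset, G' W * (if m₂ ∈ W then (1 : R) else 0))
        - (∑ W ∈ U.powerset, G W) * (∑ W ∈ U.powerset, G W * (if m₂ ∈ W then (1 : R) else 0)) *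
          (∑ W ∈ U.powerset, G' W * (if m₁ ∈ W then (1 : R) else 0))
        + (∑ W ∈ U.powerset, G W * (if m₁ ∈ W then (1 : R) else 0)) *
          (∑ W ∈ U.powerset, G W * (if m₂ ∈ W then (1 : R) else 0)) *
          (∑ W ∈ U.powerset, G' W) := by
  have hx0 := fun W => ite_mem_nonneg (R := R) m₁ W
  have hx1 := fun W => ite_mem_le_one (R := R) m₁ W
  have hy0 := fun W => ite_mem_nonneg (R := R) m₂ W
  have hy1 := fun W => ite_mem_le_one (R := R) m₂ W
  -- the atom sums
  set r₀ := ∑ W ∈ U.powerset, G W * ((1 - if m₁ ∈ W then (1 : R) else 0) * (1 - if m₂ ∈ W then (1 : R) else 0)) with hr₀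
  set r₁ := ∑ W ∈ U.powerset, G W * ((if m₁ ∈ W then (1 : R) else 0) * (1 - if m₂ ∈ W then (1 : R) else 0)) with hr₁
  set r₂ := ∑ W ∈ U.powerset, G W * ((1 - if m₁ ∈ W then (1 : R) else 0) * (if m₂ ∈ W then (1 : R) else 0)) with hr₂
  set r₁₂ := ∑ W ∈ U.powerset, G W * ((if m₁ ∈ W then (1 : R) else 0) * (if m₂ ∈ W then (1 : R) else 0)) with hr₁₂
  set g₀ := ∑ W ∈ U.powerset, G' W * ((1 - if m₁ ∈ W then (1 : R) else 0) * (1 - if m₂ ∈ W then (1 : R) else 0)) with hg₀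
  set g₁ := ∑ W ∈ U.powerset, G' W * ((if m₁ ∈ W then (1 : R) else 0) * (1 - if m₂ ∈ W then (1 : R) else 0)) with hg₁
  set g₂ := ∑ W ∈ U.powerset, G' W * ((1 - if m₁ ∈ W then (1 : R) else 0) * (if m₂ ∈ W then (1 : R) else 0)) with hg₂
  set g₁₂ := ∑ W ∈ U.powerset, G' W * ((if m₁ ∈ W then (1 : R) else 0) * (if m₂ ∈ W then (1 : R) else 0)) with hg₁₂
  have hr₀0 : 0 ≤ r₀ := Finset.sum_nonneg fun W _ =>
    mul_nonneg (hG W) (mul_nonneg (by linarith [hx1 W]) (by linarith [hy1 W]))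
  have hr₁0 : 0 ≤ r₁ := Finset.sum_nonneg fun W _ =>
    mul_nonneg (hG W) (mul_nonneg (hx0 W) (by linarith [hy1 W]))
  have hr₂0 : 0 ≤ r₂ := Finset.sum_nonneg fun W _ =>
    mul_nonneg (hG W) (mul_nonneg (by linarith [hx1 W]) (hy0 W))
  have hg₀0 : 0 ≤ g₀ := Finset.sum_nonneg fun W _ =>
    mul_nonneg (hG' W) (mul_nonneg (by linarith [hx1 W]) (by linarith [hy1 W]))
  have hg₁0 : 0 ≤ g₁ := Finset.sum_nonneg fun W _ =>
    mul_nonneg (hG' W) (mul_nonneg (hx0 W) (by linarith [hy1 W]))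
  have hg₂0 : 0 ≤ g₂ := Finset.sum_nonneg fun W _ =>
    mul_nonneg (hG' W) (mul_nonneg (by linarith [hx1 W]) (hy0 W))
  have hg₁₂0 : 0 ≤ g₁₂ := Finset.sum_nonneg fun W _ =>
    mul_nonneg (hG' W) (mul_nonneg (hx0 W) (hy0 W))
  have hr : r₁ * r₂ ≤ r₀ * r₁₂ := atom_lsm U G m₁ m₂ hG wLL
  have hg : g₁ * g₂ ≤ g₀ * g₁₂ := atom_lsm U G' m₁ m₂ hG' wMM
  -- the gate equals the `R`-law on the bottom atom and is dominated on the middle ones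
  have h0 : g₀ = r₀ := by
    refine Finset.sum_congr rfl fun W _ => ?_
    by_cases h1 : m₁ ∈ W
    · simp only [h1, if_true, sub_self, zero_mul, mul_zero]
    · by_cases h2 : m₂ ∈ W
      · simp only [h2, if_true, sub_self, mul_zero]
      · rw [h00 W h1 h2]
  have h1 : g₁ ≤ r₁ := Finset.sum_le_sum fun W _ =>
    mul_le_mul_of_nonneg_right (hle W) (mul_nonneg (hx0 W) (by linarith [hy1 W]))
  have h2 : g₂ ≤ r₂ := Finset.sum_le_sum fun W _ =>
    mul_le_mul_of_nonneg_right (hle W) (mul_nonneg (by linarith [hx1 W]) (hy0 W))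
  have key := fourAtom_sandwich r₀ r₁ r₂ r₁₂ g₀ g₁ g₂ g₁₂ hr₀0 hr₁0 hr₂0 hg₀0 hg₁0 hg₂0 hg₁₂0
    hr hg h0 h1 h2
  -- the seven sums in atom form
  have eΛ : (∑ W ∈ U.powerset, G W) = r₀ + r₁ + r₂ + r₁₂ := by
    simp only [hr₀, hr₁, hr₂, hr₁₂, ← Finset.sum_add_distrib]
    exact Finset.sum_congr rfl fun W _ => by ring
  have eΛ₁ : (∑ W ∈ U.powerset, G W * (if m₁ ∈ W then (1 : R) else 0)) = r₁ + r₁₂ := by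
    simp only [hr₁, hr₁₂, ← Finset.sum_add_distrib]
    exact Finset.sum_congr rfl fun W _ => by ring
  have eΛ₂ : (∑ W ∈ U.powerset, G W * (if m₂ ∈ W then (1 : R) else 0)) = r₂ + r₁₂ := by
    simp only [hr₂, hr₁₂, ← Finset.sum_add_distrib]
    exact Finset.sum_congr rfl fun W _ => by ring
  have eM : (∑ W ∈ U.powerset, G' W) = g₀ + g₁ + g₂ + g₁₂ := by
    simp only [hg₀, hg₁, hg₂, hg₁₂, ← Finset.sum_add_distrib]
    exact Finset.sum_congr rfl fun W _ => by ring
  have eM₁ : (∑ W ∈ U.powerset, G' W * (if m₁ ∈ W then (1 : R) else 0)) = g₁ + g₁₂ := by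
    simp only [hg₁, hg₁₂, ← Finset.sum_add_distrib]
    exact Finset.sum_congr rfl fun W _ => by ring
  have eM₂ : (∑ W ∈ U.powerset, G' W * (if m₂ ∈ W then (1 : R) else 0)) = g₂ + g₁₂ := by
    simp only [hg₂, hg₁₂, ← Finset.sum_add_distrib]
    exact Finset.sum_congr rfl fun W _ => by ring
  rw [eΛ, eΛ₁, eΛ₂, eM, eM₁, eM₂]
  unfold fourAtomT at key
  linarith [key]

/-- **THE FOUR-ATOM SANDWICH ON A CORE, hypotheses on the core levels only.** As
`fourAtom_functional_nonneg`, with `G' ≤ G` and the bottom equality assumed on `U.powerset`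
alone (the two laws may differ arbitrarily off the core). -/
theorem fourAtom_functional_nonneg' (U : Finset V) (G G' : Finset V → R) (m₁ m₂ : V)
    (hG : ∀ W, 0 ≤ G W) (hG' : ∀ W, 0 ≤ G' W)
    (wLL : ∀ s ⊆ U, ∀ t ⊆ U, G s * G t ≤ G (s ∩ t) * G (s ∪ t))
    (wMM : ∀ s ⊆ U, ∀ t ⊆ U, G' s * G' t ≤ G' (s ∩ t) * G' (s ∪ t))
    (hle : ∀ W ∈ U.powerset, G' W ≤ G W)
    (h00 : ∀ W ∈ U.powerset, m₁ ∉ W → m₂ ∉ W → G' W = G W) :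
    0 ≤ (∑ W ∈ U.powerset, G W) ^ 2 *
          (∑ W ∈ U.powerset, G' W * ((if m₁ ∈ W then (1 : R) else 0) * (if m₂ ∈ W then (1 : R) else 0)))
        - (∑ W ∈ U.powerset, G W) * (∑ W ∈ U.powerset, G W * (if m₁ ∈ W then (1 : R) else 0)) *
          (∑ W ∈ U.powerset, G' W * (if m₂ ∈ W then (1 : R) else 0))
        - (∑ W ∈ U.powerset, G W) * (∑ W ∈ U.powerset, G W * (if m₂ ∈ W then (1 : R) else 0)) *
          (∑ W ∈ U.powerset, G' W * (if m₁ ∈ W then (1 : R) else 0))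
        + (∑ W ∈ U.powerset, G W * (if m₁ ∈ W then (1 : R) else 0)) *
          (∑ W ∈ U.powerset, G W * (if m₂ ∈ W then (1 : R) else 0)) *
          (∑ W ∈ U.powerset, G' W) := by
  have hx0 := fun W => ite_mem_nonneg (R := R) m₁ W
  have hx1 := fun W => ite_mem_le_one (R := R) m₁ W
  have hy0 := fun W => ite_mem_nonneg (R := R) m₂ W
  have hy1 := fun W => ite_mem_le_one (R := R) m₂ W
  -- the atom sums
  set r₀ := ∑ W ∈ U.powerset, G W * ((1 - if m₁ ∈ W then (1 : R) else 0) * (1 - if m₂ ∈ W then (1 : R) else 0)) with hr₀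
  set r₁ := ∑ W ∈ U.powerset, G W * ((if m₁ ∈ W then (1 : R) else 0) * (1 - if m₂ ∈ W then (1 : R) else 0)) with hr₁
  set r₂ := ∑ W ∈ U.powerset, G W * ((1 - if m₁ ∈ W then (1 : R) else 0) * (if m₂ ∈ W then (1 : R) else 0)) with hr₂
  set r₁₂ := ∑ W ∈ U.powerset, G W * ((if m₁ ∈ W then (1 : R) else 0) * (if m₂ ∈ W then (1 : R) else 0)) with hr₁₂
  set g₀ := ∑ W ∈ U.powerset, G' W * ((1 - if m₁ ∈ W then (1 : R) else 0) * (1 - if m₂ ∈ W then (1 : R) else 0)) with hg₀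
  set g₁ := ∑ W ∈ U.powerset, G' W * ((if m₁ ∈ W then (1 : R) else 0) * (1 - if m₂ ∈ W then (1 : R) else 0)) with hg₁
  set g₂ := ∑ W ∈ U.powerset, G' W * ((1 - if m₁ ∈ W then (1 : R) else 0) * (if m₂ ∈ W then (1 : R) else 0)) with hg₂
  set g₁₂ := ∑ W ∈ U.powerset, G' W * ((if m₁ ∈ W then (1 : R) else 0) * (if m₂ ∈ W then (1 : R) else 0)) with hg₁₂
  have hr₀0 : 0 ≤ r₀ := Finset.sum_nonneg fun W _ =>
    mul_nonneg (hG W) (mul_nonneg (by linarith [hx1 W]) (by linarith [hy1 W]))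
  have hr₁0 : 0 ≤ r₁ := Finset.sum_nonneg fun W _ =>
    mul_nonneg (hG W) (mul_nonneg (hx0 W) (by linarith [hy1 W]))
  have hr₂0 : 0 ≤ r₂ := Finset.sum_nonneg fun W _ =>
    mul_nonneg (hG W) (mul_nonneg (by linarith [hx1 W]) (hy0 W))
  have hg₀0 : 0 ≤ g₀ := Finset.sum_nonneg fun W _ =>
    mul_nonneg (hG' W) (mul_nonneg (by linarith [hx1 W]) (by linarith [hy1 W]))
  have hg₁0 : 0 ≤ g₁ := Finset.sum_nonneg fun W _ =>
    mul_nonneg (hG' W) (mul_nonneg (hx0 W) (by linarith [hy1 W]))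
  have hg₂0 : 0 ≤ g₂ := Finset.sum_nonneg fun W _ =>
    mul_nonneg (hG' W) (mul_nonneg (by linarith [hx1 W]) (hy0 W))
  have hg₁₂0 : 0 ≤ g₁₂ := Finset.sum_nonneg fun W _ =>
    mul_nonneg (hG' W) (mul_nonneg (hx0 W) (hy0 W))
  have hr : r₁ * r₂ ≤ r₀ * r₁₂ := atom_lsm U G m₁ m₂ hG wLL
  have hg : g₁ * g₂ ≤ g₀ * g₁₂ := atom_lsm U G' m₁ m₂ hG' wMM
  -- the gate equals the `R`-law on the bottom atom and is dominated on the middle ones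
  have h0 : g₀ = r₀ := by
    refine Finset.sum_congr rfl fun W hW => ?_
    by_cases h1 : m₁ ∈ W
    · simp only [h1, if_true, sub_self, zero_mul, mul_zero]
    · by_cases h2 : m₂ ∈ W
      · simp only [h2, if_true, sub_self, mul_zero]
      · rw [h00 W hW h1 h2]
  have h1 : g₁ ≤ r₁ := Finset.sum_le_sum fun W hW =>
    mul_le_mul_of_nonneg_right (hle W hW) (mul_nonneg (hx0 W) (by linarith [hy1 W]))
  have h2 : g₂ ≤ r₂ := Finset.sum_le_sum fun W hW =>
    mul_le_mul_of_nonneg_right (hle W hW) (mul_nonneg (by linarith [hx1 W]) (hy0 W))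
  have key := fourAtom_sandwich r₀ r₁ r₂ r₁₂ g₀ g₁ g₂ g₁₂ hr₀0 hr₁0 hr₂0 hg₀0 hg₁0 hg₂0 hg₁₂0
    hr hg h0 h1 h2
  -- the seven sums in atom form
  have eΛ : (∑ W ∈ U.powerset, G W) = r₀ + r₁ + r₂ + r₁₂ := by
    simp only [hr₀, hr₁, hr₂, hr₁₂, ← Finset.sum_add_distrib]
    exact Finset.sum_congr rfl fun W _ => by ring
  have eΛ₁ : (∑ W ∈ U.powerset, G W * (if m₁ ∈ W then (1 : R) else 0)) = r₁ + r₁₂ := by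
    simp only [hr₁, hr₁₂, ← Finset.sum_add_distrib]
    exact Finset.sum_congr rfl fun W _ => by ring
  have eΛ₂ : (∑ W ∈ U.powerset, G W * (if m₂ ∈ W then (1 : R) else 0)) = r₂ + r₁₂ := by
    simp only [hr₂, hr₁₂, ← Finset.sum_add_distrib]
    exact Finset.sum_congr rfl fun W _ => by ring
  have eM : (∑ W ∈ U.powerset, G' W) = g₀ + g₁ + g₂ + g₁₂ := by
    simp only [hg₀, hg₁, hg₂, hg₁₂, ← Finset.sum_add_distrib]
    exact Finset.sum_congr rfl fun W _ => by ring
  have eM₁ : (∑ W ∈ U.powerset, G' W * (if m₁ ∈ W then (1 : R) else 0)) = g₁ + g₁₂ := by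
    simp only [hg₁, hg₁₂, ← Finset.sum_add_distrib]
    exact Finset.sum_congr rfl fun W _ => by ring
  have eM₂ : (∑ W ∈ U.powerset, G' W * (if m₂ ∈ W then (1 : R) else 0)) = g₂ + g₁₂ := by
    simp only [hg₂, hg₁₂, ← Finset.sum_add_distrib]
    exact Finset.sum_congr rfl fun W _ => by ring
  rw [eΛ, eΛ₁, eΛ₂, eM, eM₁, eM₂]
  unfold fourAtomT at key
  linarith [key]

end FourAtomPush

end Summit.Ventures.PercRepro2.Coin
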